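import Mathlib
import HarnessLib
import HarnessLib.Audit
import Summits.CriticalPhenomena.PercolationContinuityZ3.Theorems.PercNearOneGluingNoHeavyLowerTailHexMSMSEquality
import Summits.CriticalPhenomena.PercolationContinuityZ3.Theorems.PercNearOneGluingNoHeavyLowerTailHexMSMatchPureSC

/-!
# The pure SC inequality (Π2″) for a single blocker (hp-7 gen 71)

Support file for crux `stmt-CriticalPhenomena-4575` (route `PercNearOneGluingNoHeavy`), hull-port seat `prim-hp-7` (generation 71);
`--supports stmt-CriticalPhenomena-4575`.  No `sorry`.  Memo: `run/shared/lean/prim/prim-hp-7/FROM-prim-hp-7-g71-SATURATION.md` §0ter.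

`PureSC` (`…HexMSMatchPureSC`) asks, for a complement-free family `F = P ⊔ Q` and a family `W` of blocker representatives `p \ q`,
`p ∪ (U \ q)` avoiding `cl(P \\ P ∪ Q \\ Q)` and `cl F`, that the term family `scTerms P Q W` has `2 (#P + #Q + #W) ≤ #cl(scTerms)`.
`W = ∅` is projective Marica–Schönheim.  Here we PROVE THE CASE `#W = 1` for 'dead-like' blocks (pairwise intersecting and non-covering,
as dead families of an antipodal instance always are):

* `two_mul_card_add_two_le_card_clU_scTerms_singleton` — for `F = P ⊔ Q` pairwise intersecting and non-covering inside `U` and a single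
  representative `w ∈ scReps U P Q` with `w ∉ cl(P \\ P ∪ Q \\ Q)`:  `2 (#P + #Q + 1) ≤ #(clU U (scTerms P Q {w}))`.

Proof.  If `#(F \\ F) ≥ #F + 1` the differences alone suffice (for such families `F \\ F` and its complements are `2 #(F \\ F)` distinct sets).
Otherwise `F` is Marica–Schönheim tight and has a pivot `c` (`TwistedAD.exists_pivot_of_card_diffs_eq_card`); for `w = p₀ \ q₀` the members
`u = c \ w` and `v = c ∪ w` (`tp_mem_of_pivot`) satisfy `v \ u = w`, so by the avoidance hypothesis they lie in different blocks, and in either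
case the MEMBER `u` is a term (`v \ w = u`, `u \ w = u`); members of a pairwise intersecting, non-covering family are never differences of
members nor complements of such, so `{u, U \ u}` are two new sets.  For `w = p₀ ∪ (U \ q₀)` the same with `e = U \ w = q₀ \ p₀`,
`u' = c \ e ⊆ w`, `v' = c ∪ e`: the term is `w \ u' = U \ v'` or `u' ∩ w = u'`.
-/

namespace Summit.CriticalPhenomena.PercolationContinuityZ3.Theorems

namespace GeneratedDonors

open Finset FinsetFamily

variable {α : Type*} [DecidableEq α]

section SingleBlocker

variable {U : Finset α}

/-- In a pairwise intersecting, non-covering family of subsets of `U` no member is a difference of two members or the complement of one. -/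
theorem notMem_clU_diffs_of_mem {F : Finset (Finset α)} (hU : ∀ a ∈ F, a ⊆ U) (hint : ∀ a ∈ F, ∀ b ∈ F, (a ∩ b).Nonempty)
    (hcov : ∀ a ∈ F, ∀ b ∈ F, a ∪ b ≠ U) {u : Finset α} (hu : u ∈ F) : u ∉ clU U (F \\ F) := by
  intro h
  rcases mem_clU.mp h with h | ⟨t, ht, htu⟩
  · obtain ⟨a, ha, b, hb, hab⟩ := mem_diffs.mp h
    obtain ⟨i, hi⟩ := hint u hu b hb
    rw [← hab, mem_inter, mem_sdiff] at hi
    exact hi.1.2 hi.2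
  · obtain ⟨a, ha, b, hb, hab⟩ := mem_diffs.mp ht
    apply hcov u hu a ha
    apply Subset.antisymm (union_subset (hU u hu) (hU a ha))
    intro i hiU
    rw [mem_union, ← htu, ← hab, mem_sdiff, mem_sdiff]
    by_cases hia : i ∈ a
    · exact Or.inr hia
    · exact Or.inl ⟨hiU, fun h => hia h.1⟩

/-- For such a family, `F \\ F` and the complements of its members are disjoint, so `#clU (F \\ F) = 2 #(F \\ F)`. -/
theorem card_clU_diffs (F : Finset (Finset α)) (hU : ∀ a ∈ F, a ⊆ U) (hcov : ∀ a ∈ F, ∀ b ∈ F, a ∪ b ≠ U) :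
    #(clU U (F \\ F)) = 2 * #(F \\ F) := by
  classical
  unfold clU
  have hsub : ∀ t ∈ F \\ F, t ⊆ U := by
    intro t ht
    obtain ⟨a, ha, b, -, rfl⟩ := mem_diffs.mp ht
    exact sdiff_subset.trans (hU a ha)
  have hinj : Set.InjOn (fun s : Finset α => U \ s) ↑(F \\ F) := by
    intro s hs t ht hst
    have h1 := congrArg (fun r => U \ r) hst
    simp only [Finset.sdiff_sdiff_eq_self (hsub s (mem_coe.mp hs)), Finset.sdiff_sdiff_eq_self (hsub t (mem_coe.mp ht))] at h1
    exact h1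
  have hdisj : Disjoint (F \\ F) ((F \\ F).image fun s => U \ s) := by
    rw [Finset.disjoint_left]
    intro t ht htc
    obtain ⟨s, hs, hst⟩ := mem_image.mp htc
    obtain ⟨a, ha, b, hb, rfl⟩ := mem_diffs.mp ht
    obtain ⟨a', ha', b', hb', rfl⟩ := mem_diffs.mp hs
    apply hcov a ha a' ha'
    apply Subset.antisymm (union_subset (hU a ha) (hU a' ha'))
    intro i hiU
    rw [mem_union]
    by_cases hia' : i ∈ a'
    · exact Or.inr hia'
    · have : i ∈ U \ (a' \ b') := mem_sdiff.mpr ⟨hiU, fun h => hia' (mem_sdiff.mp h).1⟩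
      rw [hst] at this
      exact Or.inl (mem_sdiff.mp this).1
  rw [card_union_of_disjoint hdisj, card_image_of_injOn hinj]; ring

/-- Pure Boolean identity: `(c ∪ w) \ (c \ w) = w`. -/
theorem union_sdiff_sdiff_self (c w : Finset α) : (c ∪ w) \ (c \ w) = w := by
  ext i; simp only [mem_sdiff, mem_union]; tauto

/-- If every member of `S` is a subset of `U`, then `s ∈ clU U S ↔ U \ s ∈ clU U S` for `s ⊆ U`. -/
theorem compl_mem_clU {S : Finset (Finset α)} (hS : ∀ t ∈ S, t ⊆ U) {s : Finset α} (hs : s ⊆ U)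
    (h : s ∈ clU U S) : U \ s ∈ clU U S := by
  rcases mem_clU.mp h with h | ⟨t, ht, rfl⟩
  · exact mem_clU.mpr (Or.inr ⟨s, h, rfl⟩)
  · rw [Finset.sdiff_sdiff_eq_self (hS t ht)]
    exact mem_clU.mpr (Or.inl ht)

/-- A representative `w ∈ scReps U P Q` lies inside `U`. -/
theorem subset_of_mem_scReps {P Q : Finset (Finset α)} (hU : ∀ a ∈ P ∪ Q, a ⊆ U) {w : Finset α} (hw : w ∈ scReps U P Q) :
    w ⊆ U := by
  unfold scReps at hw
  rcases mem_union.mp hw with h | h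
  · obtain ⟨a, ha, b, -, rfl⟩ := mem_diffs.mp h
    exact sdiff_subset.trans (hU a (mem_union_left _ ha))
  · obtain ⟨pq, hpq, rfl⟩ := mem_image.mp h
    exact union_subset (hU _ (mem_union_left _ (mem_product.mp hpq).1)) sdiff_subset

/-- Every term of `scTerms P Q {w}` lies inside `U`. -/
theorem scTerms_singleton_subset_ground {P Q : Finset (Finset α)} (hU : ∀ a ∈ P ∪ Q, a ⊆ U) {w : Finset α} (hwU : w ⊆ U) :
    ∀ t ∈ scTerms P Q {w}, t ⊆ U := by
  intro t ht
  unfold scTerms at ht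
  simp only [mem_union] at ht
  have hP : ∀ a ∈ P, a ⊆ U := fun a ha => hU a (mem_union_left _ ha)
  have hQ : ∀ a ∈ Q, a ⊆ U := fun a ha => hU a (mem_union_right _ ha)
  rcases ht with ((((((h | h) | h) | h) | h) | h) | h) | h
  · obtain ⟨a, ha, b, -, rfl⟩ := mem_diffs.mp h; exact sdiff_subset.trans (hP a ha)
  · obtain ⟨a, ha, b, -, rfl⟩ := mem_diffs.mp h; exact sdiff_subset.trans (hQ a ha)
  · obtain ⟨a, ha, b, -, rfl⟩ := mem_diffs.mp h; exact sdiff_subset.trans (hP a ha)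
  · obtain ⟨a, ha, b, -, rfl⟩ := mem_diffs.mp h; exact sdiff_subset.trans (hQ a ha)
  · obtain ⟨a, ha, b, -, rfl⟩ := mem_diffs.mp h; exact sdiff_subset.trans (hP a ha)
  · obtain ⟨a, ha, b, -, rfl⟩ := mem_diffs.mp h
    rw [mem_singleton] at ha; rw [ha]; exact sdiff_subset.trans hwU
  · obtain ⟨a, ha, b, -, rfl⟩ := mem_infs.mp h
    exact inter_subset_left.trans (hQ a ha)
  · obtain ⟨a, ha, b, hb, rfl⟩ := mem_sups.mp h
    rw [mem_singleton] at hb; rw [hb]; exact union_subset (hQ a ha) hwU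

/-- **(Π2″) for a single blocker representative.**  `F = P ⊔ Q` pairwise intersecting and non-covering in `U`, `w` a representative
`p₀ \ q₀` or `p₀ ∪ (U \ q₀)` that is neither a within-block difference nor the complement of one: then `2 (#P + #Q + 1) ≤ #clU(scTerms P Q {w})`. -/
theorem two_mul_card_add_two_le_card_clU_scTerms_singleton (P Q : Finset (Finset α)) (w : Finset α)
    (hU : ∀ a ∈ P ∪ Q, a ⊆ U) (hPQ : Disjoint P Q)
    (hint : ∀ a ∈ P ∪ Q, ∀ b ∈ P ∪ Q, (a ∩ b).Nonempty) (hcov : ∀ a ∈ P ∪ Q, ∀ b ∈ P ∪ Q, a ∪ b ≠ U)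
    (hrep : w ∈ scReps U P Q) (hC2 : w ∉ clU U ((P \\ P) ∪ (Q \\ Q))) :
    2 * (#P + #Q + 1) ≤ #(clU U (scTerms P Q {w})) := by
  classical
  set F := P ∪ Q with hFdef
  set T := scTerms P Q {w} with hTdef
  have hcardF : #F = #P + #Q := card_union_of_disjoint hPQ
  have hwU : w ⊆ U := subset_of_mem_scReps hU hrep
  have hTU : ∀ t ∈ T, t ⊆ U := scTerms_singleton_subset_ground hU hwU
  have hP : ∀ {a}, a ∈ P → a ∈ F := fun ha => mem_union_left _ ha
  have hQ : ∀ {a}, a ∈ Q → a ∈ F := fun ha => mem_union_right _ ha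
  -- F \\ F ⊆ T
  have hdiffs_sub : F \\ F ⊆ T := by
    intro t ht
    obtain ⟨a, ha, b, hb, rfl⟩ := mem_diffs.mp ht
    rw [hTdef]; unfold scTerms
    simp only [mem_union]
    rcases mem_union.mp ha with ha | ha <;> rcases mem_union.mp hb with hb | hb
    · exact Or.inl (Or.inl (Or.inl (Or.inl (Or.inl (Or.inl (Or.inl (sdiff_mem_diffs ha hb)))))))
    · exact Or.inl (Or.inl (Or.inl (Or.inl (Or.inl (Or.inr (sdiff_mem_diffs ha hb))))))
    · exact Or.inl (Or.inl (Or.inl (Or.inl (Or.inr (sdiff_mem_diffs ha hb)))))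
    · exact Or.inl (Or.inl (Or.inl (Or.inl (Or.inl (Or.inl (Or.inr (sdiff_mem_diffs ha hb)))))))
  have hcl_mono : ∀ {S S' : Finset (Finset α)}, S ⊆ S' → clU U S ⊆ clU U S' := by
    intro S S' hSS' t ht
    rcases mem_clU.mp ht with h | ⟨s, hs, rfl⟩
    · exact mem_clU.mpr (Or.inl (hSS' h))
    · exact mem_clU.mpr (Or.inr ⟨s, hSS' hs, rfl⟩)
  have hsub : clU U (F \\ F) ⊆ clU U T := hcl_mono hdiffs_sub
  have hclcard : #(clU U (F \\ F)) = 2 * #(F \\ F) := card_clU_diffs F hU hcov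
  have hMS : #F ≤ #(F \\ F) := F.card_le_card_diffs
  have hcc : ∀ {a : Finset α}, a ⊆ U → U \ (U \ a) = a := fun ha => Finset.sdiff_sdiff_eq_self ha
  -- KEY COUNT: a member u of F whose orbit meets clU T gives two extra sets beyond clU (F \\ F)
  have key : ∀ u ∈ F, (u ∈ clU U T ∨ U \ u ∈ clU U T) → #(clU U (F \\ F)) + 2 ≤ #(clU U T) := by
    intro u hu hterm
    have huU : u ⊆ U := hU u hu
    have hu1 : u ∈ clU U T := by
      rcases hterm with h | h
      · exact h
      · have := compl_mem_clU hTU sdiff_subset h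
        rwa [hcc huU] at this
    have hu2 : U \ u ∈ clU U T := compl_mem_clU hTU huU hu1
    have hnot1 : u ∉ clU U (F \\ F) := notMem_clU_diffs_of_mem hU hint hcov hu
    have hnot2 : U \ u ∉ clU U (F \\ F) := by
      intro h
      have hS : ∀ t ∈ F \\ F, t ⊆ U := by
        intro t ht
        obtain ⟨a, ha, b, -, rfl⟩ := mem_diffs.mp ht
        exact sdiff_subset.trans (hU a ha)
      have := compl_mem_clU hS sdiff_subset h
      rw [hcc huU] at this
      exact hnot1 this
    have hne : u ≠ U \ u := by
      intro h
      obtain ⟨i, hi⟩ := hint u hu u hu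
      rw [mem_inter] at hi
      have := hi.1; rw [h] at this
      exact (mem_sdiff.mp this).2 hi.2
    have hpair : ({u, U \ u} : Finset (Finset α)) ⊆ clU U T := by
      intro t ht
      rcases mem_insert.mp ht with rfl | ht
      · exact hu1
      · rw [mem_singleton] at ht; rw [ht]; exact hu2
    have hdisj : Disjoint (clU U (F \\ F)) {u, U \ u} := by
      rw [Finset.disjoint_right]
      intro t ht
      rcases mem_insert.mp ht with rfl | ht
      · exact hnot1
      · rw [mem_singleton] at ht; rw [ht]; exact hnot2
    have hcard2 : #({u, U \ u} : Finset (Finset α)) = 2 := card_pair hne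
    calc #(clU U (F \\ F)) + 2 = #(clU U (F \\ F) ∪ {u, U \ u}) := by rw [card_union_of_disjoint hdisj, hcard2]
      _ ≤ #(clU U T) := card_le_card (union_subset hsub hpair)
  -- Case 1: Marica–Schönheim is not tight: the differences suffice
  by_cases htight : #(F \\ F) = #F
  swap
  · have h1 : #F + 1 ≤ #(F \\ F) := by omega
    have h2 := card_le_card hsub
    rw [hclcard] at h2
    omega
  -- Case 2: tight ⟹ pivot
  have hne : F.Nonempty := by
    unfold scReps at hrep
    rcases mem_union.mp hrep with h | h
    · obtain ⟨a, ha, -, -, -⟩ := mem_diffs.mp h; exact ⟨a, hP ha⟩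
    · obtain ⟨pq, hpq, -⟩ := mem_image.mp h; exact ⟨pq.1, hP (mem_product.mp hpq).1⟩
  obtain ⟨c, hcF, hc⟩ := TwistedAD.exists_pivot_of_card_diffs_eq_card F htight hne
  have hcard : #(F \\ F) ≤ #F := htight.le
  have hcU : c ⊆ U := hU c hcF
  -- the blocks cannot contain two members whose difference is w or U \ w
  have hsplit : ∀ u ∈ F, ∀ v ∈ F, (v \ u = w ∨ v \ u = U \ w) → (u ∈ P ∧ v ∈ Q) ∨ (u ∈ Q ∧ v ∈ P) := by
    intro u hu v hv hvu
    have hnot : ¬ ((u ∈ P ∧ v ∈ P) ∨ (u ∈ Q ∧ v ∈ Q)) := by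
      rintro (⟨huP, hvP⟩ | ⟨huQ, hvQ⟩)
      · apply hC2
        rcases hvu with h | h
        · exact mem_clU.mpr (Or.inl (mem_union_left _ (mem_diffs.mpr ⟨v, hvP, u, huP, h⟩)))
        · exact mem_clU.mpr (Or.inr ⟨v \ u, mem_union_left _ (sdiff_mem_diffs hvP huP), by rw [h, hcc hwU]⟩)
      · apply hC2
        rcases hvu with h | h
        · exact mem_clU.mpr (Or.inl (mem_union_right _ (mem_diffs.mpr ⟨v, hvQ, u, huQ, h⟩)))
        · exact mem_clU.mpr (Or.inr ⟨v \ u, mem_union_right _ (sdiff_mem_diffs hvQ huQ), by rw [h, hcc hwU]⟩)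
    rcases mem_union.mp hu with huP | huQ <;> rcases mem_union.mp hv with hvP | hvQ
    · exact absurd (Or.inl ⟨huP, hvP⟩) hnot
    · exact Or.inl ⟨huP, hvQ⟩
    · exact Or.inr ⟨huQ, hvP⟩
    · exact absurd (Or.inr ⟨huQ, hvQ⟩) hnot
  -- generic construction: for a difference e ∈ F \\ F, the members c \ e and c ∪ e
  have hmem_pair : ∀ e ∈ F \\ F, c \ e ∈ F ∧ c ∪ e ∈ F := by
    intro e he
    obtain ⟨h1, h2⟩ := mem_diffs_pivot_split hcard hc he
    have h0l : c \ c ∈ F.image (c \ ·) := mem_image.mpr ⟨c, hcF, rfl⟩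
    have h0r : c \ c ∈ F.image (· \ c) := mem_image.mpr ⟨c, hcF, rfl⟩
    have hu := tp_mem_of_pivot hcard hc (e ∩ c) h1 (c \ c) h0r
    have hv := tp_mem_of_pivot hcard hc (c \ c) h0l (e \ c) h2
    have eu : (c \ (e ∩ c)) ∪ (c \ c) = c \ e := by
      ext i; simp only [mem_union, mem_sdiff, mem_inter]; tauto
    have ev : (c \ (c \ c)) ∪ (e \ c) = c ∪ e := by
      ext i; simp only [mem_union, mem_sdiff]; tauto
    rw [eu] at hu; rw [ev] at hv
    exact ⟨hu, hv⟩
  -- the two types of representative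
  unfold scReps at hrep
  rcases mem_union.mp hrep with hw | hw
  · -- TYPE 5: w = p₀ \ q₀ ∈ F \\ F
    obtain ⟨p₀, hp₀, q₀, hq₀, hpq⟩ := mem_diffs.mp hw
    have hwd : w ∈ F \\ F := mem_diffs.mpr ⟨p₀, hP hp₀, q₀, hQ hq₀, hpq⟩
    obtain ⟨huF, hvF⟩ := hmem_pair w hwd
    have hvu : (c ∪ w) \ (c \ w) = w := union_sdiff_sdiff_self c w
    -- the member c \ w is a P-term: if c \ w ∈ P then (c \ w) \ w = c \ w; if c ∪ w ∈ P then (c ∪ w) \ w = c \ w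
    have hterm : c \ w ∈ P \\ ({w} : Finset (Finset α)) := by
      rcases hsplit (c \ w) huF (c ∪ w) hvF (Or.inl hvu) with ⟨huP, -⟩ | ⟨-, hvP⟩
      · refine mem_diffs.mpr ⟨c \ w, huP, w, mem_singleton_self w, ?_⟩
        ext i; simp only [mem_sdiff]; tauto
      · refine mem_diffs.mpr ⟨c ∪ w, hvP, w, mem_singleton_self w, ?_⟩
        ext i; simp only [mem_sdiff, mem_union]; tauto
    have hmemT : c \ w ∈ clU U T := by
      refine mem_clU.mpr (Or.inl ?_)
      rw [hTdef]; unfold scTerms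
      simp only [mem_union]
      exact Or.inl (Or.inl (Or.inl (Or.inr hterm)))
    have hk := key (c \ w) huF (Or.inl hmemT)
    rw [hclcard, htight, hcardF] at hk
    omega
  · -- TYPE 2: w = p₀ ∪ (U \ q₀); e := U \ w = q₀ \ p₀ ∈ F \\ F
    obtain ⟨pq, hpq, hpqw⟩ := mem_image.mp hw
    have hpqw' : pq.1 ∪ (U \ pq.2) = w := hpqw
    obtain ⟨hp₀, hq₀⟩ := mem_product.mp hpq
    set e := U \ w with hedef
    have hp₀U : pq.1 ⊆ U := hU _ (hP hp₀)
    have hq₀U : pq.2 ⊆ U := hU _ (hQ hq₀)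
    have he_eq : e = pq.2 \ pq.1 := by
      rw [hedef, ← hpqw']
      ext i; simp only [mem_sdiff, mem_union]
      constructor
      · rintro ⟨hiU, h⟩
        refine ⟨?_, fun h1 => h (Or.inl h1)⟩
        by_contra h2; exact h (Or.inr ⟨hiU, h2⟩)
      · rintro ⟨hi2, hi1⟩
        exact ⟨hq₀U hi2, fun h => h.elim hi1 (fun h' => h'.2 hi2)⟩
    have hed : e ∈ F \\ F := by rw [he_eq]; exact mem_diffs.mpr ⟨pq.2, hQ hq₀, pq.1, hP hp₀, rfl⟩
    obtain ⟨huF, hvF⟩ := hmem_pair e hed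
    have hvu : (c ∪ e) \ (c \ e) = e := union_sdiff_sdiff_self c e
    have hwe : w = U \ e := by rw [hedef, hcc hwU]
    rcases hsplit (c \ e) huF (c ∪ e) hvF (Or.inr (hvu.trans hedef)) with ⟨huP, -⟩ | ⟨huQ, -⟩
    · -- c \ e ∈ P: the P-term w \ (c \ e) = U \ (c ∪ e)
      have hterm : U \ (c ∪ e) ∈ ({w} : Finset (Finset α)) \\ P := by
        refine mem_diffs.mpr ⟨w, mem_singleton_self w, c \ e, huP, ?_⟩
        rw [hwe]
        ext i; simp only [mem_sdiff, mem_union]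
        constructor
        · rintro ⟨⟨hiU, hie⟩, h⟩
          exact ⟨hiU, fun h' => h'.elim (fun hic => h ⟨hic, hie⟩) hie⟩
        · rintro ⟨hiU, h⟩
          exact ⟨⟨hiU, fun hie => h (Or.inr hie)⟩, fun h' => h (Or.inl h'.1)⟩
      have hmemT : U \ (c ∪ e) ∈ clU U T := by
        refine mem_clU.mpr (Or.inl ?_)
        rw [hTdef]; unfold scTerms
        simp only [mem_union]
        exact Or.inl (Or.inl (Or.inr hterm))
      have hk := key (c ∪ e) hvF (Or.inr hmemT)
      rw [hclcard, htight, hcardF] at hk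
      omega
    · -- c \ e ∈ Q: the Q-term (c \ e) ∩ w = c \ e
      have hterm : c \ e ∈ Q ⊼ ({w} : Finset (Finset α)) := by
        refine mem_infs.mpr ⟨c \ e, huQ, w, mem_singleton_self w, ?_⟩
        rw [hwe]
        show (c \ e) ∩ (U \ e) = c \ e
        ext i; simp only [mem_inter, mem_sdiff]
        constructor
        · rintro ⟨h, -⟩; exact h
        · intro h; exact ⟨h, hcU h.1, h.2⟩
      have hmemT : c \ e ∈ clU U T := by
        refine mem_clU.mpr (Or.inl ?_)
        rw [hTdef]; unfold scTerms
        simp only [mem_union]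
        exact Or.inl (Or.inr hterm)
      have hk := key (c \ e) huF (Or.inl hmemT)
      rw [hclcard, htight, hcardF] at hk
      omega

end SingleBlocker

end GeneratedDonors

end Summit.CriticalPhenomena.PercolationContinuityZ3.Theorems
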